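import Summits.BirchSwinnertonDyer.BirchSwinnertonDyer.Theses.KatoDescentPotSupersingular
import Summits.BirchSwinnertonDyer.Rank1Residual.Supersingular.DescentLowerBound
import Summits.BirchSwinnertonDyer.Rank1Residual.Supersingular.RationalLadder
import Summits.BirchSwinnertonDyer.Rank1Residual.Additive.QuadraticTwistBSDComparisonIsogeny
import Summits.BirchSwinnertonDyer.Rank1Residual.Additive.FouquetWanLocus
import Summits.BirchSwinnertonDyer.Rank1Residual.X11b.ChaPairsMinimality
import Summits.BirchSwinnertonDyer.BirchSwinnertonDyer.Theorems.Rank1ResidualIntModelReduction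
import Literature.NumberTheory.EllipticCurves.AnomalousOfRationalTorsionProofs
import HarnessLib

/-!
# Route `KatoDescentPotSupersingular` (rung K9, cell `bsd-potss`), child crux `WildLowerIntrinsicNonCM`
# (item stmt-BirchSwinnertonDyer-19663), registered stubs `stub_intr_red` / `stub_intr_irred_residual`:
# the UNCONDITIONAL-modulo-classical-facts per-class ROAD in record SHAPE — «literal model of a
# `3`-torsion-free member `W₀` + `Sel^(3)(W₀/ℚ) ≠ 0` + `ord₃ #Ш_an(W₀) ≤ 2` ⇒ `MissingLowerBoundAt W 3`
# at every globally minimal member `W` of the class» (seat `bsd-potss-k9-desc3`, ACCEL row (2) of planner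
# bsd-potss-plan g14; a `--supports stmt-BirchSwinnertonDyer-19663` helper file; closes NOTHING class-wide)

PARTITION (D-0054, cell bsd-potss): EXCLUDED-DOMAIN non-CM additive `p` · B5 O6 wild `3`, `r_an = 0`,
INTRINSIC classes (every member has `3 ∣ #Ш_an`) × {X3 = `E[3]` reducible} ∪ {X4 rows OFF the
Kim–Kurihara road} — the rows of the registered stubs `Sig.stub_intr_red` / `Sig.stub_intr_irred_residual`
of the birth skeleton `WildLowerIntrinsicNonCM_birth.lean` (planner g14, sha 1e081a67…). Class-wide both
stubs are Kato's Conj. 12.10 (lower half) at the wild additive potentially supersingular prime `3`: an OPEN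
PROBLEM (k9-c2 g5 FIND verdict on the item; no IMC at such a prime in print). Nothing here proves them.

WHAT THIS FILE DOES. The tree already holds the class-free per-pair consumer
`Supersingular.missingLowerBoundAt_of_casselsTate_of_selmerGroup_ne_bot` (`Supersingular/DescentLowerBound.lean`,
cell b2b-bsdres: rank `0` by GZK, `p ∤ #E(ℚ)_tors`, `Sel^(p)(E/ℚ) ≠ ⊥` ⇒ `Ш[p] ≠ 0`
(`exists_sha_torsion_of_selmerGroup_ne_bot`, PROVED fundamental sequence) ⇒ `p ∣ #Ш` ⇒ `p² ∣ #Ш` by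
Cassels–Tate squareness ⇒ `MissingLowerBoundAt W p` when `ord_p #Ш_an ≤ 2`), Cassels' transport of the
lower half along a `ℚ`-isogeny (`TwistComparison.missingLowerBoundAt_of_isIsogenous`) and the k9-c2
certificate-slot files (p421575 `…WildLowerShaWitness.lean`, `…WildLowerSubgroupWitness.lean`). New here:

* §1 `3 ∤ #E(ℚ)_tors` DECIDED from a literal model: for a globally minimal `W` with an odd good prime `ℓ`
  and a prime `q ∤ #Ẽ(𝔽_ℓ)`, `q ∤ #E(ℚ)_tors` (Cauchy in `E(ℚ)_tors` + `addOrderOf T ∣ #Ẽ(𝔽_ℓ)`, Silverman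
  VII.3.1(b); tree `addOrderOf_dvd_reductionPointCount`), and its integer-model form through the schema
  count `countPoints` — the road's side condition for BOTH irreducible and reducible `E[3]` (on a reducible
  class one picks the member whose `Γ_ℚ`-stable line is `μ₃` / a non-trivial character, not `ℤ/3`);
* §2 the record SHAPE at the certificate member `W₀ = ⟨a₁,…,a₆⟩`: global minimality (`hmin`, itself
  discharged per record by the tree's Kraus criteria), an odd prime `ℓ ∤ Δ` with `3 ∤ countPoints … ℓ`
  (kernel-decided), and the DISPLAYED per-pair lines `hr` (`r_an = 0`, Cremona), `hs`/`hv`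
  (`#Ш_an(W₀) = s`, `ord₃ s ≤ 2`), `hSel : Sel^(3)(W₀/ℚ) ≠ ⊥` (EVIDENCE = an explicit `3`-descent /
  `3`-isogeny-descent element, kit j250472 / j250560 of seat k9-c2 and this seat's re-runs) ⇒
  `MissingLowerBoundAt W₀ 3`; and §3 its transport to every globally minimal `W ∼_ℚ W₀` (Cassels
  `hCassels`, modularity `hmod`);
* §4 the two registered stubs VERBATIM with ONE such certificate per row's class as an explicit
  hypothesis (`…_of_selmerCertificates`): the honest conditional form — the hypothesis restricted to the
  census is what the records instantiate; class-wide it is the stub itself.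

HONEST LABEL: per class this is a finite certificate road over four PUBLISHED facts taken by name
(Cassels–Tate `exists_casselsTate_pairing`, Cassels `bsdRHS_eq_of_isIsogenous`, GZK
`rank_eq_analyticRank_of_analyticRank_le_one`, modularity `hasEntireLFunction_rat`); the Selmer line is
a binder whose evidence lives outside the kernel; BSD is not proved; the item is NOT closed; nothing is
booked here. THEOREMS ONLY (no definition, no named fact, no `sorry`).

References: [SilvermanAEC2009] VII.3.1(b), VII.3.4, X.4.14; [Cassels1965ArithmeticVIII];
[MilneADT2006] Thm. I.7.3; [Miller2011LMS] Def. 1.1; [Kato2004Asterisque] Conj. 12.10 (p. 224);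
[SchaeferStoll2004] (the certificate engine).
-/

set_option autoImplicit false
-- sibling precedent (`KatoDescentPotSupersingularAssembly.lean`): the directory name repeats the summit name
set_option linter.dupNamespace false

noncomputable section

open scoped Classical

namespace Summit.BirchSwinnertonDyer.BirchSwinnertonDyer.Theorems

open WeierstrassCurve Literature.NumberTheory.EllipticCurves
  Literature.NumberTheory.EllipticCurves.Rank1Residual
  Literature.NumberTheory.EllipticCurves.Rank1Residual.Typed
  Literature.NumberTheory.EllipticCurves.Rank1Residual.X11RankOneCertificates
  Summit.BirchSwinnertonDyer.BirchSwinnertonDyer.Rank1Residual.IntModel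
  Summit.BirchSwinnertonDyer.Rank1Residual
  Summit.BirchSwinnertonDyer.Rank1Residual.Additive
  Summit.BirchSwinnertonDyer.Rank1Residual.Supersingular
  Summit.BirchSwinnertonDyer.BirchSwinnertonDyer.Theses.KatoDescentPotSupersingular

/-! ## §1 `q ∤ #E(ℚ)_tors` from one good odd prime `ℓ` with `q ∤ #Ẽ(𝔽_ℓ)` -/

section Torsion

variable (W : WeierstrassCurve ℚ) [W.IsElliptic] [W.IsGloballyMinimal]

/-- **`q ∤ #E(ℚ)_tors` from a good odd prime `ℓ` with `q ∤ #Ẽ(𝔽_ℓ)`.** For `W/ℚ` globally minimal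
elliptic, a prime `ℓ ≥ 3` with `ℓ ∤ Δ_W` and a prime `q` not dividing `N_ℓ = #Ẽ(𝔽_ℓ)`: `q ∤ #E(ℚ)_tors`
— a rational point of order `q` (Cauchy, tree `exists_addOrderOf_eq_of_dvd_torsionOrder`) would have
`q = addOrderOf T ∣ N_ℓ` (tree `addOrderOf_dvd_reductionPointCount`: `E(ℚ)_tors ↪ Ẽ(𝔽_ℓ)` for odd good
`ℓ`). [cite: SilvermanAEC2009, VII.3.1(b) and VII.3.4] -/
theorem K9Desc3.not_dvd_torsionOrder_of_not_dvd_reductionPointCount (ℓ : ℕ) [Fact ℓ.Prime]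
    (hℓ : 3 ≤ ℓ) (hΔ : ¬ (ℓ : ℤ) ∣ minimalDiscriminantInt W) (q : ℕ) [Fact q.Prime]
    (hq : ¬ q ∣ W.reductionPointCount ℓ) : ¬ q ∣ W.torsionOrder := by
  intro h
  obtain ⟨T, hT⟩ := exists_addOrderOf_eq_of_dvd_torsionOrder W q h
  have hfin : IsOfFinAddOrder T :=
    addOrderOf_pos_iff.mp (by rw [hT]; exact (Fact.out : q.Prime).pos)
  have hdvd := addOrderOf_dvd_reductionPointCount W ℓ hℓ hΔ hfin
  rw [hT] at hdvd
  exact hq hdvd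

/-- **Integer-model form** (the shape `decide` evaluates): for a globally minimal `W` with integer model
`⟨a₁,…,a₆⟩`, an odd prime `ℓ ∤ Δ(a)` with schema count `countPoints [a₁,…,a₆] ℓ = n` and a prime
`q ∤ n`: `q ∤ #E(ℚ)_tors`. [cite: SilvermanAEC2009, VII.3.1(b) and VII.5 Prop. 5.1(a)] -/
theorem K9Desc3.not_dvd_torsionOrder_of_intModel_countPoints {a1 a2 a3 a4 a6 : ℤ}
    (hI : integralModelInt W = ⟨a1, a2, a3, a4, a6⟩) (ℓ : ℕ) [Fact ℓ.Prime] (hℓ : 3 ≤ ℓ)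
    (hℓΔ : ¬ (ℓ : ℤ) ∣ discOf [a1, a2, a3, a4, a6]) {n : ℕ}
    (hc : countPoints [a1, a2, a3, a4, a6] ℓ = n) (q : ℕ) [Fact q.Prime] (hqn : ¬ q ∣ n) :
    ¬ q ∣ W.torsionOrder := by
  have hℓ2 : ℓ ≠ 2 := by omega
  refine K9Desc3.not_dvd_torsionOrder_of_not_dvd_reductionPointCount W ℓ hℓ
    (not_dvd_minimalDiscriminantInt_of_intModel hI hℓΔ) q ?_
  rw [reductionPointCount_eq_of_intModel_countPoints hI ℓ hℓ2 hℓΔ hc]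
  exact hqn

end Torsion

/-! ## §2 The record SHAPE at the certificate member `W₀ = ⟨a₁,…,a₆⟩` -/

/-- **RECORD SHAPE — `MissingLowerBoundAt W₀ 3` at a literal `3`-torsion-free member from the Selmer
certificate line.** Inputs by name: Cassels–Tate (`hCT`), GZK (`hGZK`); of the literal model
`⟨a₁,…,a₆⟩`: global minimality (`hmin`), an odd prime `ℓ ∤ Δ` with `#Ẽ(𝔽_ℓ) = n`, `3 ∤ n` (`hℓ`, `hℓΔ`,
`hc`, `h3n`: `3 ∤ #E(ℚ)_tors`, §1); per pair: `r_an = 0` (`hr`), `#Ш_an = s` with `ord₃ s ≤ 2` (`hs`, `hv`)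
and `Sel^(3)(E/ℚ) ≠ ⊥` (`hSel`, the certificate line). Conclusion =
`Supersingular.missingLowerBoundAt_of_casselsTate_of_selmerGroup_ne_bot` on the literal model: rank `0`
(GZK) and no rational `3`-torsion make `Sel^(3) ≅ Ш[3]` non-zero ⇒ `3 ∣ #Ш` ⇒ `9 ∣ #Ш` (Cassels–Tate) ⇒
`ord₃ #Ш_an ≤ 2 ≤ ord₃ #Ш`. No reduction-type or image hypothesis. Per pair; nothing booked.
[cite: SilvermanAEC2009, Thm. X.4.14 and VII.3.1(b)] [cite: Miller2011LMS, §1 and Def. 1.1] -/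
theorem K9Desc3.missingLowerBoundAt_three_of_ainvs_of_selmerGroup_ne_bot
    (hCT : exists_casselsTate_pairing (K := ℚ)) (hGZK : rank_eq_analyticRank_of_analyticRank_le_one)
    (a1 a2 a3 a4 a6 : ℤ) (hmin : (⟨a1, a2, a3, a4, a6⟩ : WeierstrassCurve ℚ).IsGloballyMinimal)
    (ℓ : ℕ) (hℓp : ℓ.Prime) (hℓ : 3 ≤ ℓ) (hℓΔ : ¬ (ℓ : ℤ) ∣ discOf [a1, a2, a3, a4, a6]) {n : ℕ}
    (hc : countPoints [a1, a2, a3, a4, a6] ℓ = n) (h3n : ¬ 3 ∣ n)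
    (hr : (⟨a1, a2, a3, a4, a6⟩ : WeierstrassCurve ℚ).analyticRank = 0)
    {s : ℚ} (hs : shaAn (⟨a1, a2, a3, a4, a6⟩ : WeierstrassCurve ℚ) = (s : ℂ))
    (hv : padicValRat 3 s ≤ 2)
    (hSel : (⟨a1, a2, a3, a4, a6⟩ : WeierstrassCurve ℚ).selmerGroup (3 : ℤ) ≠ ⊥) :
    MissingLowerBoundAt (⟨a1, a2, a3, a4, a6⟩ : WeierstrassCurve ℚ) 3 := by
  have h0 : discOf [a1, a2, a3, a4, a6] ≠ 0 := fun h ↦ hℓΔ (by rw [h]; exact dvd_zero _)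
  haveI := X11b.isElliptic_of_discOf_ne_zero a1 a2 a3 a4 a6 h0
  haveI := hmin
  haveI : Fact ℓ.Prime := ⟨hℓp⟩
  haveI : Fact (Nat.Prime 3) := ⟨Nat.prime_three⟩
  have hI : integralModelInt (⟨a1, a2, a3, a4, a6⟩ : WeierstrassCurve ℚ) = ⟨a1, a2, a3, a4, a6⟩ :=
    integralModelInt_eq_of_map_eq _ (map_mk_int a1 a2 a3 a4 a6)
  have htors : ¬ 3 ∣ (⟨a1, a2, a3, a4, a6⟩ : WeierstrassCurve ℚ).torsionOrder :=
    K9Desc3.not_dvd_torsionOrder_of_intModel_countPoints _ hI ℓ hℓ hℓΔ hc 3 h3n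
  exact Supersingular.missingLowerBoundAt_of_casselsTate_of_selmerGroup_ne_bot _ 3 hCT hGZK hr htors
    hs hv hSel

/-! ## §3 … and at every globally minimal member of the class (Cassels transport) -/

/-- **`MissingLowerBoundAt W 3` at EVERY globally minimal member `W` of the `ℚ`-isogeny class of a
certified member** (class-free): if `W₀` is globally minimal of analytic rank `0` with `3 ∤ #W₀(ℚ)_tors`,
`#Ш_an(W₀) = s`, `ord₃ s ≤ 2` and `Sel^(3)(W₀/ℚ) ≠ ⊥`, then the lower half holds at every globally minimal
`W ∼_ℚ W₀` — §2's chain at `W₀`, then Cassels' transport (the class defect `ord₃ #Ш − ord₃ #Ш_an` is an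
isogeny invariant: `TwistComparison.missingLowerBoundAt_of_isIsogenous`, over Cassels `hCassels` + GZK +
modularity `hmod`). Conditional on the four published facts and the certificate line.
[cite: MilneADT2006, Thm. I.7.3] [cite: SilvermanAEC2009, Thm. X.4.14] [cite: Miller2011LMS, §1 and Def. 1.1] -/
theorem K9Desc3.missingLowerBoundAt_three_of_isIsogenous_of_selmerGroup_ne_bot
    (hCT : exists_casselsTate_pairing (K := ℚ)) (hCassels : bsdRHS_eq_of_isIsogenous)
    (hGZK : rank_eq_analyticRank_of_analyticRank_le_one) (hmod : hasEntireLFunction_rat)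
    (W₀ : WeierstrassCurve ℚ) [W₀.IsElliptic] [W₀.IsGloballyMinimal] (hr : W₀.analyticRank = 0)
    (htors : ¬ 3 ∣ W₀.torsionOrder) {s : ℚ} (hs : shaAn W₀ = (s : ℂ)) (hv : padicValRat 3 s ≤ 2)
    (hSel : W₀.selmerGroup (3 : ℤ) ≠ ⊥)
    (W : WeierstrassCurve ℚ) [W.IsElliptic] [W.IsGloballyMinimal] (hiso : IsIsogenous W W₀) :
    MissingLowerBoundAt W 3 := by
  haveI : Fact (Nat.Prime 3) := ⟨Nat.prime_three⟩
  have hr' : W₀.analyticRank ≤ 1 := by rw [hr]; exact zero_le_one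
  exact TwistComparison.missingLowerBoundAt_of_isIsogenous W₀ W 3 hCassels hGZK hmod
    hiso.symm_of_charZero hr'
    (Supersingular.missingLowerBoundAt_of_casselsTate_of_selmerGroup_ne_bot W₀ 3 hCT hGZK hr htors hs
      hv hSel)

/-- **RECORD SHAPE along the class — literal certificate member.** As §2 (`W₀ = ⟨a₁,…,a₆⟩` globally
minimal, odd good `ℓ` with `3 ∤ #Ẽ(𝔽_ℓ)`, `r_an = 0`, `ord₃ #Ш_an(W₀) ≤ 2`, `Sel^(3)(W₀/ℚ) ≠ ⊥`) plus
Cassels `hCassels` and modularity `hmod`: `MissingLowerBoundAt W 3` at every globally minimal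
`W ∼_ℚ W₀` (the binder `hiso` is the Cremona/LMFDB isogeny-class datum). Per class; nothing booked.
[cite: MilneADT2006, Thm. I.7.3] [cite: SilvermanAEC2009, Thm. X.4.14 and VII.3.1(b)]
[cite: Miller2011LMS, §1 and Def. 1.1] -/
theorem K9Desc3.missingLowerBoundAt_three_of_isIsogenous_ainvs_of_selmerGroup_ne_bot
    (hCT : exists_casselsTate_pairing (K := ℚ)) (hCassels : bsdRHS_eq_of_isIsogenous)
    (hGZK : rank_eq_analyticRank_of_analyticRank_le_one) (hmod : hasEntireLFunction_rat)
    (a1 a2 a3 a4 a6 : ℤ) (hmin : (⟨a1, a2, a3, a4, a6⟩ : WeierstrassCurve ℚ).IsGloballyMinimal)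
    (ℓ : ℕ) (hℓp : ℓ.Prime) (hℓ : 3 ≤ ℓ) (hℓΔ : ¬ (ℓ : ℤ) ∣ discOf [a1, a2, a3, a4, a6]) {n : ℕ}
    (hc : countPoints [a1, a2, a3, a4, a6] ℓ = n) (h3n : ¬ 3 ∣ n)
    (hr : (⟨a1, a2, a3, a4, a6⟩ : WeierstrassCurve ℚ).analyticRank = 0)
    {s : ℚ} (hs : shaAn (⟨a1, a2, a3, a4, a6⟩ : WeierstrassCurve ℚ) = (s : ℂ))
    (hv : padicValRat 3 s ≤ 2)
    (hSel : (⟨a1, a2, a3, a4, a6⟩ : WeierstrassCurve ℚ).selmerGroup (3 : ℤ) ≠ ⊥)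
    (W : WeierstrassCurve ℚ) [W.IsElliptic] [W.IsGloballyMinimal]
    (hiso : IsIsogenous W (⟨a1, a2, a3, a4, a6⟩ : WeierstrassCurve ℚ)) :
    MissingLowerBoundAt W 3 := by
  have h0 : discOf [a1, a2, a3, a4, a6] ≠ 0 := fun h ↦ hℓΔ (by rw [h]; exact dvd_zero _)
  haveI := X11b.isElliptic_of_discOf_ne_zero a1 a2 a3 a4 a6 h0
  haveI := hmin
  haveI : Fact ℓ.Prime := ⟨hℓp⟩
  haveI : Fact (Nat.Prime 3) := ⟨Nat.prime_three⟩
  have hI : integralModelInt (⟨a1, a2, a3, a4, a6⟩ : WeierstrassCurve ℚ) = ⟨a1, a2, a3, a4, a6⟩ :=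
    integralModelInt_eq_of_map_eq _ (map_mk_int a1 a2 a3 a4 a6)
  have htors : ¬ 3 ∣ (⟨a1, a2, a3, a4, a6⟩ : WeierstrassCurve ℚ).torsionOrder :=
    K9Desc3.not_dvd_torsionOrder_of_intModel_countPoints _ hI ℓ hℓ hℓΔ hc 3 h3n
  exact K9Desc3.missingLowerBoundAt_three_of_isIsogenous_of_selmerGroup_ne_bot hCT hCassels hGZK hmod
    _ hr htors hs hv hSel W hiso

/-! ## §4 The two registered stubs VERBATIM from one Selmer certificate per class -/

/-- **`Sig.stub_intr_red` (birth skeleton of 19663, VERBATIM conclusion) from the four published facts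
and ONE SELMER CERTIFICATE PER CLASS.** `hwit`: every intrinsic non-CM reducible-mod-`3` wild rank-`0` row
`W` has, in its `ℚ`-isogeny class, a globally minimal member `W₀` with `3 ∤ #W₀(ℚ)_tors`,
`ord₃ #Ш_an(W₀) ≤ 2` and `Sel^(3)(W₀/ℚ) ≠ ⊥` (the per-class certificate slot; census k9-c2 j250560 +
this seat's records: the `3`-torsion-free `#Ш_an = 9` member of the X3 classes off the 29 mirror
classes). HONEST LABEL: a per-class road made uniform by hypothesis — class-wide `hwit` is the stub's own
content (Kato 12.10 lower half at wild `3`, reducible `E[3]`; open); conditional; the item is NOT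
closed. [cite: Kato2004Asterisque, Conj. 12.10 (p. 224)] [cite: SilvermanAEC2009, Thm. X.4.14]
[cite: MilneADT2006, Thm. I.7.3] [cite: Miller2011LMS, §1 and Def. 1.1] -/
theorem K9Desc3.stub_intr_red_of_selmerCertificates
    (hCT : exists_casselsTate_pairing (K := ℚ)) (hCassels : bsdRHS_eq_of_isIsogenous)
    (hGZK : rank_eq_analyticRank_of_analyticRank_le_one) (hmod : hasEntireLFunction_rat)
    (hwit : ∀ (W : WeierstrassCurve ℚ) [W.IsElliptic] [W.IsGloballyMinimal] [Fact (3 : ℕ).Prime],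
      W.analyticRank = 0 → ClassO6 W 3 → ¬ Irr W 3 → ¬ W.HasCM →
      (∀ (W' : WeierstrassCurve ℚ) [W'.IsElliptic] [W'.IsGloballyMinimal], IsIsogenous W W' →
        ∀ q' : ℚ, shaAn W' = (q' : ℂ) → 0 < padicValRat 3 q') →
      ∃ (W₀ : WeierstrassCurve ℚ) (_ : W₀.IsElliptic) (_ : W₀.IsGloballyMinimal),
        IsIsogenous W W₀ ∧ W₀.analyticRank = 0 ∧ ¬ 3 ∣ W₀.torsionOrder ∧
        ∃ s : ℚ, shaAn W₀ = (s : ℂ) ∧ padicValRat 3 s ≤ 2 ∧ W₀.selmerGroup (3 : ℤ) ≠ ⊥) :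
    ∀ (W : WeierstrassCurve ℚ) [W.IsElliptic] [W.IsGloballyMinimal] [Fact (3 : ℕ).Prime],
      W.analyticRank = 0 → ClassO6 W 3 → ¬ Irr W 3 → ¬ W.HasCM →
      (∀ (W' : WeierstrassCurve ℚ) [W'.IsElliptic] [W'.IsGloballyMinimal], IsIsogenous W W' →
        ∀ q' : ℚ, shaAn W' = (q' : ℂ) → 0 < padicValRat 3 q') →
      MissingLowerBoundAt W 3 := by
  intro W _ _ _ hr hO hred hCM hI
  obtain ⟨W₀, hE₀, hM₀, hiso, hr₀, htors, s, hs, hv, hSel⟩ := hwit W hr hO hred hCM hI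
  haveI := hE₀
  haveI := hM₀
  exact K9Desc3.missingLowerBoundAt_three_of_isIsogenous_of_selmerGroup_ne_bot hCT hCassels hGZK hmod
    W₀ hr₀ htors hs hv hSel W hiso

/-- **`Sig.stub_intr_irred_residual` (birth skeleton of 19663, VERBATIM conclusion) from the four published
facts and ONE SELMER CERTIFICATE PER CLASS.** `hwit`: every intrinsic non-CM irreducible-mod-`3` wild
rank-`0` row off the Fouquet–Wan locus and off the Kim–Kurihara road (tower not onto, or `E(ℚ₃)[3] ≠ 0`,
or `3 ∣ ∏ c_ℓ`) has, in its class, a globally minimal member `W₀` with `3 ∤ #W₀(ℚ)_tors` (automatic: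
`E[3]` irreducible), `ord₃ #Ш_an(W₀) ≤ 2` and `Sel^(3)(W₀/ℚ) ≠ ⊥` (census k9-c2 j250472: every intrinsic
X4 class but the 11 DEEP ones, `#Ш_an = 81` at the minimal member). HONEST LABEL as above: class-wide
`hwit` is the stub (Kato 12.10 lower half, open); conditional; the item is NOT closed. The row predicates
are the skeleton's, inlined: `LocIrr`, `FWNonsplitRam`, the Kim-row triple.
[cite: Kato2004Asterisque, Conj. 12.10 (p. 224)] [cite: SilvermanAEC2009, Thm. X.4.14]
[cite: MilneADT2006, Thm. I.7.3] [cite: Miller2011LMS, §1 and Def. 1.1] -/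
theorem K9Desc3.stub_intr_irred_residual_of_selmerCertificates
    (hCT : exists_casselsTate_pairing (K := ℚ)) (hCassels : bsdRHS_eq_of_isIsogenous)
    (hGZK : rank_eq_analyticRank_of_analyticRank_le_one) (hmod : hasEntireLFunction_rat)
    (hwit : ∀ (W : WeierstrassCurve ℚ) [W.IsElliptic] [W.IsGloballyMinimal] [Fact (3 : ℕ).Prime],
      W.analyticRank = 0 → ClassO6 W 3 → Irr W 3 → ¬ (LocIrr W 3 ∧ FWNonsplitRam W 3) →
      ¬ ((∀ n : ℕ, W.HasSurjectiveModNGaloisRep (3 ^ n : ℕ)) ∧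
          Nat.card {Q : (W.baseChange ℚ_[3]).toAffine.Point // (3 : ℕ) • Q = 0} = 1 ∧
          ¬ 3 ∣ W.tamagawaProduct) →
      ¬ W.HasCM →
      (∀ (W' : WeierstrassCurve ℚ) [W'.IsElliptic] [W'.IsGloballyMinimal], IsIsogenous W W' →
        ∀ q' : ℚ, shaAn W' = (q' : ℂ) → 0 < padicValRat 3 q') →
      ∃ (W₀ : WeierstrassCurve ℚ) (_ : W₀.IsElliptic) (_ : W₀.IsGloballyMinimal),
        IsIsogenous W W₀ ∧ W₀.analyticRank = 0 ∧ ¬ 3 ∣ W₀.torsionOrder ∧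
        ∃ s : ℚ, shaAn W₀ = (s : ℂ) ∧ padicValRat 3 s ≤ 2 ∧ W₀.selmerGroup (3 : ℤ) ≠ ⊥) :
    ∀ (W : WeierstrassCurve ℚ) [W.IsElliptic] [W.IsGloballyMinimal] [Fact (3 : ℕ).Prime],
      W.analyticRank = 0 → ClassO6 W 3 → Irr W 3 → ¬ (LocIrr W 3 ∧ FWNonsplitRam W 3) →
      ¬ ((∀ n : ℕ, W.HasSurjectiveModNGaloisRep (3 ^ n : ℕ)) ∧
          Nat.card {Q : (W.baseChange ℚ_[3]).toAffine.Point // (3 : ℕ) • Q = 0} = 1 ∧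
          ¬ 3 ∣ W.tamagawaProduct) →
      ¬ W.HasCM →
      (∀ (W' : WeierstrassCurve ℚ) [W'.IsElliptic] [W'.IsGloballyMinimal], IsIsogenous W W' →
        ∀ q' : ℚ, shaAn W' = (q' : ℂ) → 0 < padicValRat 3 q') →
      MissingLowerBoundAt W 3 := by
  intro W _ _ _ hr hO hirr hloc hK hCM hI
  obtain ⟨W₀, hE₀, hM₀, hiso, hr₀, htors, s, hs, hv, hSel⟩ := hwit W hr hO hirr hloc hK hCM hI
  haveI := hE₀
  haveI := hM₀
  exact K9Desc3.missingLowerBoundAt_three_of_isIsogenous_of_selmerGroup_ne_bot hCT hCassels hGZK hmod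
    W₀ hr₀ htors hs hv hSel W hiso

end Summit.BirchSwinnertonDyer.BirchSwinnertonDyer.Theorems

end
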